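import Mathlib
import Summits.Ventures.PercRepro2.BHKPair

/-!
# Row 2′C1: the exact decomposition of the slack into the H-determinant, the L-determinant and two
product terms (blind cell PercRepro2, p2 g31; proofs/P2-G31-DETH.md §1, §3)

With `Q = {a₁ ↮ a₂}`, `C₁ = C(a₁)`, `C₂ = C(a₂)`, `U = C₁ ∪ C₂`, `N = ∉ U`, and the masses
`m_xy = P(Q, b ∈ x, o ∈ y)` (`x, y ∈ {H, L, N}`, `H = C₂`, `L = C₁`):

  `P(Q)·P(Q, b ∈ U, o ∈ U) − P(Q, b ∈ C₂)·P(Q, o ∈ U)`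
    `= det_H + det_L + P(Q, b ∈ C₂, o ∈ U)·P(Q, b ∈ C₁) + P(Q, b ∈ C₁, o ∈ U)·P(Q, b ∉ C₂)`,
  `det_H = m_HH m_NN − m_HN m_NH`,  `det_L = m_HL m_NN − m_HN m_NL`

(`slack_eq_detH_add_lpart`).  The identity is pure bookkeeping: under `Q` the status of a mark is
exactly one of `H, L, N`, so every probability is a linear combination of the nine moments
`E[1_Q 1_{b∈x} 1_{o∈y}]`, and the two sides agree as polynomials in them.  Since `det_H ≥ 0` is a
theorem (`RowC1DetH.lean`, `detH_nonneg`), **row 2′C1 is implied by the L-part**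
`LPartNonneg`: `m_HN·m_NL ≤ m_HL·m_NN + P(Q, b ∈ C₂, o ∈ U)·P(Q, b ∈ C₁) + P(Q, b ∈ C₁, o ∈ U)·P(Q, b ∉ C₂)`
(`RowC1LPart.lean`, `c1_of_lpart`).  Std axioms.
-/

namespace Summit.Ventures.PercRepro2

namespace RowC1

section Decomp

open Classical

variable {V : Type*} {E : Type*} [Fintype E] [DecidableEq E]
  {R : Type*} [CommRing R]

/-- The indicator `1_Q`, `Q = {a₁ ↮ a₂}`. -/
noncomputable def sQ (ends : E → Sym2 V) (a₁ a₂ : V) (ω : Config E) : R :=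
  ((connEvent ends a₁ a₂)ᶜ).indicator 1 ω

/-- The indicator `1[x ∈ C(s)]`. -/
noncomputable def sC (ends : E → Sym2 V) (s x : V) (ω : Config E) : R :=
  (connEvent ends s x).indicator 1 ω

omit [Fintype E] [DecidableEq E] in
/-- Under `Q` a mark cannot lie in both root clusters. -/
lemma not_both {ends : E → Sym2 V} {ω : Config E} {a₁ a₂ x : V}
    (hQ : ω ∈ (connEvent ends a₁ a₂)ᶜ) (h₂ : ω ∈ connEvent ends a₂ x) :
    ω ∉ connEvent ends a₁ x :=
  fun h₁ => hQ (conn_trans h₁ (conn_symm h₂))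

omit [Fintype E] [DecidableEq E] in
/-- The three exclusive statuses of a mark under `Q`. -/
lemma status {ends : E → Sym2 V} {ω : Config E} {a₁ a₂ x : V}
    (hQ : ω ∈ (connEvent ends a₁ a₂)ᶜ) :
    (ω ∈ connEvent ends a₂ x ∧ ω ∉ connEvent ends a₁ x) ∨
      (ω ∉ connEvent ends a₂ x ∧ ω ∈ connEvent ends a₁ x) ∨
      (ω ∉ connEvent ends a₂ x ∧ ω ∉ connEvent ends a₁ x) := by
  by_cases h₂ : ω ∈ connEvent ends a₂ x
  · exact Or.inl ⟨h₂, not_both hQ h₂⟩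
  · by_cases h₁ : ω ∈ connEvent ends a₁ x
    · exact Or.inr (Or.inl ⟨h₂, h₁⟩)
    · exact Or.inr (Or.inr ⟨h₂, h₁⟩)

/-! ### Every probability of the identity as a combination of the nine moments
`E[1_Q 1_{b∈x} 1_{o∈y}]`.  Each proof is the same case analysis on the two statuses. -/

/-- The moment `E[1_Q · f]` for a product of status indicators; notation only. -/
noncomputable def mom (p : E → R) (ends : E → Sym2 V) (a₁ a₂ : V) (f : Config E → R) : R :=
  expect p (fun ω => sQ ends a₁ a₂ ω * f ω)

/-- `P(Q) = E[1_Q]`. -/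
lemma prob_Q (p : E → R) (ends : E → Sym2 V) (a₁ a₂ : V) :
    prob p (connEvent ends a₁ a₂)ᶜ = mom p ends a₁ a₂ (fun _ => 1) := by
  unfold mom sQ
  rw [prob_eq_expect_indicator]
  refine congrArg (expect p) (funext fun ω => ?_)
  simp

/-- `P(Q, b ∈ C₂) = E[1_Q 1_{bH}]`. -/
lemma prob_bH (p : E → R) (ends : E → Sym2 V) (a₁ a₂ b : V) :
    prob p (connEvent ends a₂ b ∩ (connEvent ends a₁ a₂)ᶜ) =
      mom p ends a₁ a₂ (fun ω => sC ends a₂ b ω) := by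
  unfold mom sQ sC
  rw [prob_eq_expect_indicator]
  refine congrArg (expect p) (funext fun ω => ?_)
  by_cases hQ : ω ∈ (connEvent ends a₁ a₂)ᶜ <;> by_cases hb : ω ∈ connEvent ends a₂ b <;>
    simp [Set.indicator, hQ, hb]

/-- `P(Q, b ∈ C₁) = E[1_Q 1_{bL}]`. -/
lemma prob_bL (p : E → R) (ends : E → Sym2 V) (a₁ a₂ b : V) :
    prob p (connEvent ends a₁ b ∩ (connEvent ends a₁ a₂)ᶜ) =
      mom p ends a₁ a₂ (fun ω => sC ends a₁ b ω) := by
  unfold mom sQ sC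
  rw [prob_eq_expect_indicator]
  refine congrArg (expect p) (funext fun ω => ?_)
  by_cases hQ : ω ∈ (connEvent ends a₁ a₂)ᶜ <;> by_cases hb : ω ∈ connEvent ends a₁ b <;>
    simp [Set.indicator, hQ, hb]

/-- `P(Q, b ∉ C₂) = E[1_Q (1 − 1_{bH})]`. -/
lemma prob_nbH (p : E → R) (ends : E → Sym2 V) (a₁ a₂ b : V) :
    prob p ((connEvent ends a₂ b)ᶜ ∩ (connEvent ends a₁ a₂)ᶜ) =
      mom p ends a₁ a₂ (fun ω => 1 - sC ends a₂ b ω) := by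
  unfold mom sQ sC
  rw [prob_eq_expect_indicator]
  refine congrArg (expect p) (funext fun ω => ?_)
  by_cases hQ : ω ∈ (connEvent ends a₁ a₂)ᶜ <;> by_cases hb : ω ∈ connEvent ends a₂ b <;>
    simp [Set.indicator, hQ, hb]

/-- `P(Q, o ∈ U) = E[1_Q (1_{oH} + 1_{oL})]`. -/
lemma prob_oU (p : E → R) (ends : E → Sym2 V) (a₁ a₂ o : V) :
    prob p ((connEvent ends a₁ o ∪ connEvent ends a₂ o) ∩ (connEvent ends a₁ a₂)ᶜ) =
      mom p ends a₁ a₂ (fun ω => sC ends a₂ o ω + sC ends a₁ o ω) := by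
  unfold mom sQ sC
  rw [prob_eq_expect_indicator]
  refine congrArg (expect p) (funext fun ω => ?_)
  by_cases hQ : ω ∈ (connEvent ends a₁ a₂)ᶜ
  · rcases status (x := o) hQ with ⟨h₂, h₁⟩ | ⟨h₂, h₁⟩ | ⟨h₂, h₁⟩ <;>
      simp [Set.indicator, hQ, h₁, h₂]
  · simp [Set.indicator, hQ]

/-- `P(Q, b ∈ U, o ∈ U) = E[1_Q (1_{bH} + 1_{bL})(1_{oH} + 1_{oL})]`. -/
lemma prob_bUoU (p : E → R) (ends : E → Sym2 V) (a₁ a₂ o b : V) :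
    prob p ((connEvent ends a₁ o ∪ connEvent ends a₂ o) ∩
        (connEvent ends a₁ b ∪ connEvent ends a₂ b) ∩ (connEvent ends a₁ a₂)ᶜ) =
      mom p ends a₁ a₂ (fun ω => (sC ends a₂ b ω + sC ends a₁ b ω) *
        (sC ends a₂ o ω + sC ends a₁ o ω)) := by
  unfold mom sQ sC
  rw [prob_eq_expect_indicator]
  refine congrArg (expect p) (funext fun ω => ?_)
  by_cases hQ : ω ∈ (connEvent ends a₁ a₂)ᶜ
  · rcases status (x := o) hQ with ⟨h₂, h₁⟩ | ⟨h₂, h₁⟩ | ⟨h₂, h₁⟩ <;>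
      rcases status (x := b) hQ with ⟨h₄, h₃⟩ | ⟨h₄, h₃⟩ | ⟨h₄, h₃⟩ <;>
      simp [Set.indicator, hQ, h₁, h₂, h₃, h₄]
  · simp [Set.indicator, hQ]

/-- `P(Q, b ∈ C₂, o ∈ U) = E[1_Q 1_{bH}(1_{oH} + 1_{oL})]`. -/
lemma prob_bHoU (p : E → R) (ends : E → Sym2 V) (a₁ a₂ o b : V) :
    prob p (connEvent ends a₂ b ∩ (connEvent ends a₁ o ∪ connEvent ends a₂ o) ∩
        (connEvent ends a₁ a₂)ᶜ) =
      mom p ends a₁ a₂ (fun ω => sC ends a₂ b ω * (sC ends a₂ o ω + sC ends a₁ o ω)) := by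
  unfold mom sQ sC
  rw [prob_eq_expect_indicator]
  refine congrArg (expect p) (funext fun ω => ?_)
  by_cases hQ : ω ∈ (connEvent ends a₁ a₂)ᶜ
  · rcases status (x := o) hQ with ⟨h₂, h₁⟩ | ⟨h₂, h₁⟩ | ⟨h₂, h₁⟩ <;>
      by_cases hb : ω ∈ connEvent ends a₂ b <;> simp [Set.indicator, hQ, h₁, h₂, hb]
  · simp [Set.indicator, hQ]

/-- `P(Q, b ∈ C₁, o ∈ U) = E[1_Q 1_{bL}(1_{oH} + 1_{oL})]`. -/
lemma prob_bLoU (p : E → R) (ends : E → Sym2 V) (a₁ a₂ o b : V) :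
    prob p (connEvent ends a₁ b ∩ (connEvent ends a₁ o ∪ connEvent ends a₂ o) ∩
        (connEvent ends a₁ a₂)ᶜ) =
      mom p ends a₁ a₂ (fun ω => sC ends a₁ b ω * (sC ends a₂ o ω + sC ends a₁ o ω)) := by
  unfold mom sQ sC
  rw [prob_eq_expect_indicator]
  refine congrArg (expect p) (funext fun ω => ?_)
  by_cases hQ : ω ∈ (connEvent ends a₁ a₂)ᶜ
  · rcases status (x := o) hQ with ⟨h₂, h₁⟩ | ⟨h₂, h₁⟩ | ⟨h₂, h₁⟩ <;>
      by_cases hb : ω ∈ connEvent ends a₁ b <;> simp [Set.indicator, hQ, h₁, h₂, hb]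
  · simp [Set.indicator, hQ]

/-- `m_HH = E[1_Q 1_{bH} 1_{oH}]`. -/
lemma prob_HH (p : E → R) (ends : E → Sym2 V) (a₁ a₂ o b : V) :
    prob p (connEvent ends a₂ b ∩ connEvent ends a₂ o ∩ (connEvent ends a₁ a₂)ᶜ) =
      mom p ends a₁ a₂ (fun ω => sC ends a₂ b ω * sC ends a₂ o ω) := by
  unfold mom sQ sC
  rw [prob_eq_expect_indicator]
  refine congrArg (expect p) (funext fun ω => ?_)
  by_cases hQ : ω ∈ (connEvent ends a₁ a₂)ᶜ <;> by_cases hb : ω ∈ connEvent ends a₂ b <;>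
    by_cases ho : ω ∈ connEvent ends a₂ o <;> simp [Set.indicator, hQ, hb, ho]

/-- `m_HL = E[1_Q 1_{bH} 1_{oL}]`. -/
lemma prob_HL (p : E → R) (ends : E → Sym2 V) (a₁ a₂ o b : V) :
    prob p (connEvent ends a₂ b ∩ connEvent ends a₁ o ∩ (connEvent ends a₁ a₂)ᶜ) =
      mom p ends a₁ a₂ (fun ω => sC ends a₂ b ω * sC ends a₁ o ω) := by
  unfold mom sQ sC
  rw [prob_eq_expect_indicator]
  refine congrArg (expect p) (funext fun ω => ?_)
  by_cases hQ : ω ∈ (connEvent ends a₁ a₂)ᶜ <;> by_cases hb : ω ∈ connEvent ends a₂ b <;>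
    by_cases ho : ω ∈ connEvent ends a₁ o <;> simp [Set.indicator, hQ, hb, ho]

/-- `m_HN = E[1_Q 1_{bH}(1 − 1_{oH} − 1_{oL})]`. -/
lemma prob_HN (p : E → R) (ends : E → Sym2 V) (a₁ a₂ o b : V) :
    prob p (connEvent ends a₂ b ∩ (connEvent ends a₁ o ∪ connEvent ends a₂ o)ᶜ ∩
        (connEvent ends a₁ a₂)ᶜ) =
      mom p ends a₁ a₂ (fun ω => sC ends a₂ b ω * (1 - sC ends a₂ o ω - sC ends a₁ o ω)) := by
  unfold mom sQ sC
  rw [prob_eq_expect_indicator]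
  refine congrArg (expect p) (funext fun ω => ?_)
  by_cases hQ : ω ∈ (connEvent ends a₁ a₂)ᶜ
  · rcases status (x := o) hQ with ⟨h₂, h₁⟩ | ⟨h₂, h₁⟩ | ⟨h₂, h₁⟩ <;>
      by_cases hb : ω ∈ connEvent ends a₂ b <;> simp [Set.indicator, hQ, h₁, h₂, hb]
  · simp [Set.indicator, hQ]

/-- `m_NH = E[1_Q (1 − 1_{bH} − 1_{bL}) 1_{oH}]`. -/
lemma prob_NH (p : E → R) (ends : E → Sym2 V) (a₁ a₂ o b : V) :
    prob p ((connEvent ends a₁ b ∪ connEvent ends a₂ b)ᶜ ∩ connEvent ends a₂ o ∩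
        (connEvent ends a₁ a₂)ᶜ) =
      mom p ends a₁ a₂ (fun ω => (1 - sC ends a₂ b ω - sC ends a₁ b ω) * sC ends a₂ o ω) := by
  unfold mom sQ sC
  rw [prob_eq_expect_indicator]
  refine congrArg (expect p) (funext fun ω => ?_)
  by_cases hQ : ω ∈ (connEvent ends a₁ a₂)ᶜ
  · rcases status (x := b) hQ with ⟨h₂, h₁⟩ | ⟨h₂, h₁⟩ | ⟨h₂, h₁⟩ <;>
      by_cases ho : ω ∈ connEvent ends a₂ o <;> simp [Set.indicator, hQ, h₁, h₂, ho]
  · simp [Set.indicator, hQ]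

/-- `m_NL = E[1_Q (1 − 1_{bH} − 1_{bL}) 1_{oL}]`. -/
lemma prob_NL (p : E → R) (ends : E → Sym2 V) (a₁ a₂ o b : V) :
    prob p ((connEvent ends a₁ b ∪ connEvent ends a₂ b)ᶜ ∩ connEvent ends a₁ o ∩
        (connEvent ends a₁ a₂)ᶜ) =
      mom p ends a₁ a₂ (fun ω => (1 - sC ends a₂ b ω - sC ends a₁ b ω) * sC ends a₁ o ω) := by
  unfold mom sQ sC
  rw [prob_eq_expect_indicator]
  refine congrArg (expect p) (funext fun ω => ?_)
  by_cases hQ : ω ∈ (connEvent ends a₁ a₂)ᶜ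
  · rcases status (x := b) hQ with ⟨h₂, h₁⟩ | ⟨h₂, h₁⟩ | ⟨h₂, h₁⟩ <;>
      by_cases ho : ω ∈ connEvent ends a₁ o <;> simp [Set.indicator, hQ, h₁, h₂, ho]
  · simp [Set.indicator, hQ]

/-- `m_NN = E[1_Q (1 − 1_{bH} − 1_{bL})(1 − 1_{oH} − 1_{oL})]`. -/
lemma prob_NN (p : E → R) (ends : E → Sym2 V) (a₁ a₂ o b : V) :
    prob p ((connEvent ends a₁ b ∪ connEvent ends a₂ b)ᶜ ∩
        (connEvent ends a₁ o ∪ connEvent ends a₂ o)ᶜ ∩ (connEvent ends a₁ a₂)ᶜ) =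
      mom p ends a₁ a₂ (fun ω => (1 - sC ends a₂ b ω - sC ends a₁ b ω) *
        (1 - sC ends a₂ o ω - sC ends a₁ o ω)) := by
  unfold mom sQ sC
  rw [prob_eq_expect_indicator]
  refine congrArg (expect p) (funext fun ω => ?_)
  by_cases hQ : ω ∈ (connEvent ends a₁ a₂)ᶜ
  · rcases status (x := o) hQ with ⟨h₂, h₁⟩ | ⟨h₂, h₁⟩ | ⟨h₂, h₁⟩ <;>
      rcases status (x := b) hQ with ⟨h₄, h₃⟩ | ⟨h₄, h₃⟩ | ⟨h₄, h₃⟩ <;>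
      simp [Set.indicator, hQ, h₁, h₂, h₃, h₄]
  · simp [Set.indicator, hQ]

/-! ### Linearity of the moments -/

/-- `mom` is additive. -/
lemma mom_add (p : E → R) (ends : E → Sym2 V) (a₁ a₂ : V) (f g : Config E → R) :
    mom p ends a₁ a₂ (fun ω => f ω + g ω) = mom p ends a₁ a₂ f + mom p ends a₁ a₂ g := by
  unfold mom
  rw [← expect_add]
  refine congrArg (expect p) (funext fun ω => ?_)
  simp only [Pi.add_apply]; ring

/-- `mom` respects subtraction. -/
lemma mom_sub (p : E → R) (ends : E → Sym2 V) (a₁ a₂ : V) (f g : Config E → R) :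
    mom p ends a₁ a₂ (fun ω => f ω - g ω) = mom p ends a₁ a₂ f - mom p ends a₁ a₂ g := by
  unfold mom
  rw [← expect_sub]
  refine congrArg (expect p) (funext fun ω => ?_)
  simp only [Pi.sub_apply]; ring

/-- `mom` of a constant multiple. -/
lemma mom_const_mul (p : E → R) (ends : E → Sym2 V) (a₁ a₂ : V) (c : R) (f : Config E → R) :
    mom p ends a₁ a₂ (fun ω => c * f ω) = c * mom p ends a₁ a₂ f := by
  unfold mom
  rw [← expect_const_mul]
  refine congrArg (expect p) (funext fun ω => ?_)
  ring

/-! ### Expansions into the nine moments -/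

/-- A generic expansion tactic: unfold the moments into sums and compare termwise. -/
lemma mom_expand (p : E → R) (ends : E → Sym2 V) (a₁ a₂ : V) (f : Config E → R)
    (g : Config E → R) (h : ∀ ω, sQ ends a₁ a₂ ω * f ω = g ω) :
    mom p ends a₁ a₂ f = expect p g := by
  unfold mom
  exact congrArg (expect p) (funext h)

/-! ### The identity -/

/-- **The exact decomposition of the slack of row 2′C1**:
`P(Q)·P(Q, bU, oU) − P(Q, bH)·P(Q, oU) = det_H + det_L + P(Q, bH, oU)·P(Q, bL) + P(Q, bL, oU)·P(Q, b∉H)`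
with `det_H = m_HH·m_NN − m_HN·m_NH` and `det_L = m_HL·m_NN − m_HN·m_NL`. -/
theorem slack_eq_detH_add_lpart (p : E → R) (ends : E → Sym2 V) (a₁ a₂ o b : V) :
    prob p (connEvent ends a₁ a₂)ᶜ *
        prob p ((connEvent ends a₁ o ∪ connEvent ends a₂ o) ∩
          (connEvent ends a₁ b ∪ connEvent ends a₂ b) ∩ (connEvent ends a₁ a₂)ᶜ) -
      prob p (connEvent ends a₂ b ∩ (connEvent ends a₁ a₂)ᶜ) *
        prob p ((connEvent ends a₁ o ∪ connEvent ends a₂ o) ∩ (connEvent ends a₁ a₂)ᶜ) =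
    (prob p (connEvent ends a₂ b ∩ connEvent ends a₂ o ∩ (connEvent ends a₁ a₂)ᶜ) *
        prob p ((connEvent ends a₁ b ∪ connEvent ends a₂ b)ᶜ ∩
          (connEvent ends a₁ o ∪ connEvent ends a₂ o)ᶜ ∩ (connEvent ends a₁ a₂)ᶜ) -
      prob p (connEvent ends a₂ b ∩ (connEvent ends a₁ o ∪ connEvent ends a₂ o)ᶜ ∩
          (connEvent ends a₁ a₂)ᶜ) *
        prob p ((connEvent ends a₁ b ∪ connEvent ends a₂ b)ᶜ ∩ connEvent ends a₂ o ∩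
          (connEvent ends a₁ a₂)ᶜ)) +
    (prob p (connEvent ends a₂ b ∩ connEvent ends a₁ o ∩ (connEvent ends a₁ a₂)ᶜ) *
        prob p ((connEvent ends a₁ b ∪ connEvent ends a₂ b)ᶜ ∩
          (connEvent ends a₁ o ∪ connEvent ends a₂ o)ᶜ ∩ (connEvent ends a₁ a₂)ᶜ) -
      prob p (connEvent ends a₂ b ∩ (connEvent ends a₁ o ∪ connEvent ends a₂ o)ᶜ ∩
          (connEvent ends a₁ a₂)ᶜ) *
        prob p ((connEvent ends a₁ b ∪ connEvent ends a₂ b)ᶜ ∩ connEvent ends a₁ o ∩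
          (connEvent ends a₁ a₂)ᶜ)) +
    prob p (connEvent ends a₂ b ∩ (connEvent ends a₁ o ∪ connEvent ends a₂ o) ∩
        (connEvent ends a₁ a₂)ᶜ) *
      prob p (connEvent ends a₁ b ∩ (connEvent ends a₁ a₂)ᶜ) +
    prob p (connEvent ends a₁ b ∩ (connEvent ends a₁ o ∪ connEvent ends a₂ o) ∩
        (connEvent ends a₁ a₂)ᶜ) *
      prob p ((connEvent ends a₂ b)ᶜ ∩ (connEvent ends a₁ a₂)ᶜ) := by
  rw [prob_Q, prob_bUoU, prob_bH, prob_oU, prob_HH, prob_NN, prob_HN, prob_NH, prob_HL, prob_NL,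
    prob_bHoU, prob_bL, prob_bLoU, prob_nbH]
  -- the nine moments
  have e1 : mom p ends a₁ a₂ (fun _ => 1) = expect p (fun ω => sQ ends a₁ a₂ ω) :=
    mom_expand p ends a₁ a₂ _ _ fun ω => by ring
  have e2 : mom p ends a₁ a₂ (fun ω => (sC ends a₂ b ω + sC ends a₁ b ω) *
      (sC ends a₂ o ω + sC ends a₁ o ω)) =
      expect p (fun ω => sQ ends a₁ a₂ ω * sC ends a₂ b ω * sC ends a₂ o ω) +
      expect p (fun ω => sQ ends a₁ a₂ ω * sC ends a₂ b ω * sC ends a₁ o ω) +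
      expect p (fun ω => sQ ends a₁ a₂ ω * sC ends a₁ b ω * sC ends a₂ o ω) +
      expect p (fun ω => sQ ends a₁ a₂ ω * sC ends a₁ b ω * sC ends a₁ o ω) := by
    rw [← expect_add, ← expect_add, ← expect_add]
    exact mom_expand p ends a₁ a₂ _ _ fun ω => by simp only [Pi.add_apply]; ring
  have e3 : mom p ends a₁ a₂ (fun ω => sC ends a₂ b ω) =
      expect p (fun ω => sQ ends a₁ a₂ ω * sC ends a₂ b ω) :=
    mom_expand p ends a₁ a₂ _ _ fun ω => rfl
  have e4 : mom p ends a₁ a₂ (fun ω => sC ends a₂ o ω + sC ends a₁ o ω) =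
      expect p (fun ω => sQ ends a₁ a₂ ω * sC ends a₂ o ω) +
      expect p (fun ω => sQ ends a₁ a₂ ω * sC ends a₁ o ω) := by
    rw [← expect_add]
    exact mom_expand p ends a₁ a₂ _ _ fun ω => by simp only [Pi.add_apply]; ring
  have e5 : mom p ends a₁ a₂ (fun ω => sC ends a₂ b ω * sC ends a₂ o ω) =
      expect p (fun ω => sQ ends a₁ a₂ ω * sC ends a₂ b ω * sC ends a₂ o ω) :=
    mom_expand p ends a₁ a₂ _ _ fun ω => by ring
  have e6 : mom p ends a₁ a₂ (fun ω => (1 - sC ends a₂ b ω - sC ends a₁ b ω) *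
      (1 - sC ends a₂ o ω - sC ends a₁ o ω)) =
      expect p (fun ω => sQ ends a₁ a₂ ω) -
      expect p (fun ω => sQ ends a₁ a₂ ω * sC ends a₂ b ω) -
      expect p (fun ω => sQ ends a₁ a₂ ω * sC ends a₁ b ω) -
      expect p (fun ω => sQ ends a₁ a₂ ω * sC ends a₂ o ω) -
      expect p (fun ω => sQ ends a₁ a₂ ω * sC ends a₁ o ω) +
      expect p (fun ω => sQ ends a₁ a₂ ω * sC ends a₂ b ω * sC ends a₂ o ω) +
      expect p (fun ω => sQ ends a₁ a₂ ω * sC ends a₂ b ω * sC ends a₁ o ω) +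
      expect p (fun ω => sQ ends a₁ a₂ ω * sC ends a₁ b ω * sC ends a₂ o ω) +
      expect p (fun ω => sQ ends a₁ a₂ ω * sC ends a₁ b ω * sC ends a₁ o ω) := by
    rw [← expect_sub, ← expect_sub, ← expect_sub, ← expect_sub, ← expect_add, ← expect_add,
      ← expect_add, ← expect_add]
    exact mom_expand p ends a₁ a₂ _ _ fun ω => by simp only [Pi.add_apply, Pi.sub_apply]; ring
  have e7 : mom p ends a₁ a₂ (fun ω => sC ends a₂ b ω * (1 - sC ends a₂ o ω - sC ends a₁ o ω)) =
      expect p (fun ω => sQ ends a₁ a₂ ω * sC ends a₂ b ω) -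
      expect p (fun ω => sQ ends a₁ a₂ ω * sC ends a₂ b ω * sC ends a₂ o ω) -
      expect p (fun ω => sQ ends a₁ a₂ ω * sC ends a₂ b ω * sC ends a₁ o ω) := by
    rw [← expect_sub, ← expect_sub]
    exact mom_expand p ends a₁ a₂ _ _ fun ω => by simp only [Pi.sub_apply]; ring
  have e8 : mom p ends a₁ a₂ (fun ω => (1 - sC ends a₂ b ω - sC ends a₁ b ω) * sC ends a₂ o ω) =
      expect p (fun ω => sQ ends a₁ a₂ ω * sC ends a₂ o ω) -
      expect p (fun ω => sQ ends a₁ a₂ ω * sC ends a₂ b ω * sC ends a₂ o ω) -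
      expect p (fun ω => sQ ends a₁ a₂ ω * sC ends a₁ b ω * sC ends a₂ o ω) := by
    rw [← expect_sub, ← expect_sub]
    exact mom_expand p ends a₁ a₂ _ _ fun ω => by simp only [Pi.sub_apply]; ring
  have e9 : mom p ends a₁ a₂ (fun ω => sC ends a₂ b ω * sC ends a₁ o ω) =
      expect p (fun ω => sQ ends a₁ a₂ ω * sC ends a₂ b ω * sC ends a₁ o ω) :=
    mom_expand p ends a₁ a₂ _ _ fun ω => by ring
  have e10 : mom p ends a₁ a₂ (fun ω => (1 - sC ends a₂ b ω - sC ends a₁ b ω) * sC ends a₁ o ω) =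
      expect p (fun ω => sQ ends a₁ a₂ ω * sC ends a₁ o ω) -
      expect p (fun ω => sQ ends a₁ a₂ ω * sC ends a₂ b ω * sC ends a₁ o ω) -
      expect p (fun ω => sQ ends a₁ a₂ ω * sC ends a₁ b ω * sC ends a₁ o ω) := by
    rw [← expect_sub, ← expect_sub]
    exact mom_expand p ends a₁ a₂ _ _ fun ω => by simp only [Pi.sub_apply]; ring
  have e11 : mom p ends a₁ a₂ (fun ω => sC ends a₂ b ω * (sC ends a₂ o ω + sC ends a₁ o ω)) =
      expect p (fun ω => sQ ends a₁ a₂ ω * sC ends a₂ b ω * sC ends a₂ o ω) +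
      expect p (fun ω => sQ ends a₁ a₂ ω * sC ends a₂ b ω * sC ends a₁ o ω) := by
    rw [← expect_add]
    exact mom_expand p ends a₁ a₂ _ _ fun ω => by simp only [Pi.add_apply]; ring
  have e12 : mom p ends a₁ a₂ (fun ω => sC ends a₁ b ω) =
      expect p (fun ω => sQ ends a₁ a₂ ω * sC ends a₁ b ω) :=
    mom_expand p ends a₁ a₂ _ _ fun ω => rfl
  have e13 : mom p ends a₁ a₂ (fun ω => sC ends a₁ b ω * (sC ends a₂ o ω + sC ends a₁ o ω)) =
      expect p (fun ω => sQ ends a₁ a₂ ω * sC ends a₁ b ω * sC ends a₂ o ω) +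
      expect p (fun ω => sQ ends a₁ a₂ ω * sC ends a₁ b ω * sC ends a₁ o ω) := by
    rw [← expect_add]
    exact mom_expand p ends a₁ a₂ _ _ fun ω => by simp only [Pi.add_apply]; ring
  have e14 : mom p ends a₁ a₂ (fun ω => 1 - sC ends a₂ b ω) =
      expect p (fun ω => sQ ends a₁ a₂ ω) -
      expect p (fun ω => sQ ends a₁ a₂ ω * sC ends a₂ b ω) := by
    rw [← expect_sub]
    exact mom_expand p ends a₁ a₂ _ _ fun ω => by simp only [Pi.sub_apply]; ring
  rw [e1, e2, e3, e4, e5, e6, e7, e8, e9, e10, e11, e12, e13, e14]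
  ring

end Decomp

end RowC1

end Summit.Ventures.PercRepro2
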